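import Literature.RepresentationTheory.HeisenbergGroup.SchrodingerCommutantPi
import Literature.RepresentationTheory.HeisenbergGroup.SymplecticMatrixTransport
import HarnessLib

/-!
# Rank `n`: `Sp(F^ι ⊕ F^ι)` is generated by the Siegel parabolic and the Weyl element; every `g` is implemented on
# `𝒮(F^ι)`; the local metaplectic-type extension is a central extension (KERNEL)

Topic `RepresentationTheory/HeisenbergGroup`; namespace `Literature.RepresentationTheory.HeisenbergGroup`.

KERNEL throughout; no records. Sequel of `SchrodingerCommutantPi.lean` (uniqueness of implementers) completing,
in every finite rank, what `SchrodingerCommutant.lean` §4 does in rank one: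
* §1 **the transport `Sp_{2ι}(K) → Sp(W, β_T)` of `SymplecticMatrixTransport.lean` is SURJECTIVE** (hence
  bijective) for every commutative ring `K` and Gram matrix `T` with unit determinant: the matrix of
  `P ∘ g ∘ P⁻¹` in Darboux coordinates is symplectic (`transportSp_surjective`);
* §2 the standard duality `⟨x, y⟩ = Σ xᵢ yᵢ` (`dotProductBilin`, the pairing of the Schrödinger model on `𝒮(F^ι)` and
  of `LocalPiSchwartzBruhatFourier.piWeylPair_mem_mpPairs`) IS `β_1` (`toLinearMap₂'_one_eq_dotProductBilin`), so
  **`Sp(F^ι ⊕ F^ι) = symplecticGroup (polar dotProductBilin)` is generated by the Levi elements `m(a, d)`, the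
  unipotents `n(b)` (`b` symmetric) and the Weyl element `(x, y) ↦ (y, -x)`** over any field
  (`symplecticGroup_pi_eq_top_of_mem`; [MoeglinVignerasWaldspurger1987] Chap. 2 II.5–II.6, Mathlib's big-cell lemma
  through `SymplecticSiegelGeneration`);
* §3 **existence of implementers on `𝒮(F^ι)`** for `F` non-archimedean local, `ψ` continuous non-trivial, `2 ≠ 0`
  (`existsImplementer_schrodingerSB_pi`: Levi and unipotent operators of `SchrodingerSymplecticGenerators`, the
  Fourier automorphism of `𝒮(F^ι)` for the Weyl element), and **the central extension
  `1 → ℂˣ → S̃p_ψ(F^ι ⊕ F^ι) → Sp(F^ι ⊕ F^ι) → 1`, KERNEL, hypothesis-free** (`isCentralExt_schrodingerSB_pi`;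
  [MoeglinVignerasWaldspurger1987] Chap. 2 II.1 (A)–(B)).

## References

* [MoeglinVignerasWaldspurger1987] C. Mœglin, M.-F. Vignéras, J.-L. Waldspurger, *Correspondances de Howe sur un
  corps p-adique*, LNM 1291 (1987), Chap. 2 II.1, II.5, II.6.
* [Weil1964] A. Weil, *Sur certains groupes d'opérateurs unitaires*, Acta Math. 111 (1964), n° 5–6, 13.
-/

set_option autoImplicit false

noncomputable section

open Matrix

namespace Literature.RepresentationTheory.HeisenbergGroup

open _root_.MeasureTheory
open Literature.NumberTheory.Automorphic
open SymplecticMatrix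

/-! ## §1 The transport is surjective -/

section Transport

variable {K : Type*} [CommRing K] {ι : Type*} [Fintype ι] [DecidableEq ι] (T : Matrix ι ι K) (hT : IsUnit T.det)

/-- the matrix of `g ∈ Sp(W, β_T)` in Darboux coordinates: `P ∘ g ∘ P⁻¹`. [folklore] -/
def darbouxMatrix (g : ((ι → K) × (ι → K)) ≃ₗ[K] ((ι → K) × (ι → K))) : Matrix (ι ⊕ ι) (ι ⊕ ι) K :=
  LinearMap.toMatrix' (((darboux T hT : ((ι → K) × (ι → K)) ≃ₗ[K] (ι ⊕ ι → K)) : ((ι → K) × (ι → K)) →ₗ[K] (ι ⊕ ι → K))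
    ∘ₗ (g : ((ι → K) × (ι → K)) →ₗ[K] ((ι → K) × (ι → K))) ∘ₗ
    (((darboux T hT).symm : (ι ⊕ ι → K) ≃ₗ[K] ((ι → K) × (ι → K))) : (ι ⊕ ι → K) →ₗ[K] ((ι → K) × (ι → K))))

/-- `darbouxMatrix g u = P (g (P⁻¹ u))`. [cite: Weil1964, n° 5, p. 150] -/
theorem darbouxMatrix_mulVec (g : ((ι → K) × (ι → K)) ≃ₗ[K] ((ι → K) × (ι → K))) (u : ι ⊕ ι → K) :
    darbouxMatrix T hT g *ᵥ u = darboux T hT (g ((darboux T hT).symm u)) := by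
  rw [darbouxMatrix, LinearMap.toMatrix'_mulVec]
  rfl

/-- **the Darboux matrix of an element of `Sp(W, β_T)` is a symplectic matrix** (`Aᵀ J A = J`; Weil's `σ σᴵ = 1`).
[cite: Weil1964, n° 5, p. 150] -/
theorem darbouxMatrix_mem_symplecticGroup (g : symplecticGroup (polar (Matrix.toLinearMap₂' K T))) :
    darbouxMatrix T hT (g : ((ι → K) × (ι → K)) ≃ₗ[K] ((ι → K) × (ι → K))) ∈ Matrix.symplecticGroup ι K := by
  set A := darbouxMatrix T hT (g : ((ι → K) × (ι → K)) ≃ₗ[K] ((ι → K) × (ι → K))) with hA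
  have hg : ∀ v w : (ι → K) × (ι → K),
      alt (polar (Matrix.toLinearMap₂' K T)) ((g : ((ι → K) × (ι → K)) ≃ₗ[K] ((ι → K) × (ι → K))) v)
        ((g : ((ι → K) × (ι → K)) ≃ₗ[K] ((ι → K) × (ι → K))) w) = alt (polar (Matrix.toLinearMap₂' K T)) v w :=
    fun v w => (mem_symplecticGroup _ _).1 g.2 v w
  -- the `J`-form is preserved by `A`
  have key : ∀ u u' : ι ⊕ ι → K, (A *ᵥ u) ⬝ᵥ (Matrix.J ι K *ᵥ (A *ᵥ u')) = u ⬝ᵥ (Matrix.J ι K *ᵥ u') := by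
    intro u u'
    have h := hg ((darboux T hT).symm u) ((darboux T hT).symm u')
    rw [alt_polar_eq_neg_jForm, alt_polar_eq_neg_jForm, neg_inj] at h
    have e : ∀ w : (ι → K) × (ι → K), Sum.elim w.1 (T *ᵥ w.2) = darboux T hT w := fun w => rfl
    rw [e, e, e, e, LinearEquiv.apply_symm_apply, LinearEquiv.apply_symm_apply] at h
    rw [hA, darbouxMatrix_mulVec, darbouxMatrix_mulVec]
    exact h
  rw [SymplecticGroup.mem_iff']
  have hinj : Function.Injective
      (Matrix.toLinearMap₂' K : Matrix (ι ⊕ ι) (ι ⊕ ι) K → (ι ⊕ ι → K) →ₗ[K] (ι ⊕ ι → K) →ₗ[K] K) :=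
    (Matrix.toLinearMap₂' K).injective
  refine hinj (LinearMap.ext fun u => LinearMap.ext fun u' => ?_)
  rw [Matrix.toLinearMap₂'_apply', Matrix.toLinearMap₂'_apply', ← Matrix.mulVec_mulVec, ← Matrix.mulVec_mulVec,
    dotProduct_mulVec, Matrix.vecMul_transpose]
  exact key u u'

/-- **the transport `Sp_{2ι}(K) → Sp(W, β_T)` is surjective**: `g = P⁻¹ A P` with `A` the Darboux matrix of `g`
(every automorphism of `A` is a symplectic matrix in a symplectic basis). [cite: Weil1964, n° 5, p. 150] -/
theorem transportSp_surjective : Function.Surjective (transportSp T hT) := by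
  intro g
  refine ⟨⟨darbouxMatrix T hT (g : ((ι → K) × (ι → K)) ≃ₗ[K] ((ι → K) × (ι → K))),
    darbouxMatrix_mem_symplecticGroup T hT g⟩, ?_⟩
  apply Subtype.ext
  apply LinearEquiv.ext
  intro v
  rw [coe_transportSp_apply]
  change (darboux T hT).symm (darbouxMatrix T hT _ *ᵥ darboux T hT v) = _
  rw [darbouxMatrix_mulVec, LinearEquiv.symm_apply_apply, LinearEquiv.symm_apply_apply]

/-- the transport is a bijection `Sp_{2ι}(K) ≃ Sp(W, β_T)`. [cite: Weil1964, n° 5, p. 150] -/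
theorem transportSp_bijective : Function.Bijective (transportSp T hT) :=
  ⟨transportSp_injective T hT, transportSp_surjective T hT⟩

/-- hence its range is everything. [cite: Weil1964, n° 5, p. 150] -/
theorem range_transportSp_eq_top : (transportSp T hT).range = ⊤ :=
  MonoidHom.range_eq_top.2 (transportSp_surjective T hT)

end Transport

/-! ## §2 The standard duality `⟨x, y⟩ = Σ xᵢ yᵢ` and the generation of `Sp(F^ι ⊕ F^ι)` -/

section Standard

variable (K : Type*) [CommRing K] (ι : Type*) [Fintype ι] [DecidableEq ι]

/-- `β_1 = ⟨·, ·⟩`: the Gram-matrix duality of `T = 1` is `dotProductBilin`. [cite: Weil1964, n° 5, p. 150] -/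
theorem toLinearMap₂'_one_eq_dotProductBilin :
    Matrix.toLinearMap₂' K (1 : Matrix ι ι K) = dotProductBilin K K (m := ι) := by
  refine LinearMap.ext fun x => LinearMap.ext fun y => ?_
  rw [Matrix.toLinearMap₂'_apply', Matrix.one_mulVec, dotProductBilin_apply_apply]

/-- hence the two symplectic groups coincide (as subgroups of `GL(F^ι ⊕ F^ι)`). [cite: Weil1964, n° 5, p. 150] -/
theorem symplecticGroup_toLinearMap₂'_one :
    symplecticGroup (polar (Matrix.toLinearMap₂' K (1 : Matrix ι ι K))) =
      symplecticGroup (polar (dotProductBilin K K (m := ι))) := by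
  rw [toLinearMap₂'_one_eq_dotProductBilin]

/-- `det 1` is a unit. [folklore] -/
private theorem isUnit_det_one' : IsUnit (1 : Matrix ι ι K).det := by
  rw [Matrix.det_one]; exact isUnit_one

/-- **the standard transport** `Sp_{2ι}(K) →* Sp(K^ι ⊕ K^ι) = symplecticGroup (polar dotProductBilin)`:
`transportSp 1` followed by the identification `β_1 = ⟨·, ·⟩`. [folklore] -/
def transportSpPi : Matrix.symplecticGroup ι K →* symplecticGroup (polar (dotProductBilin K K (m := ι))) :=
  (MulEquiv.subgroupCongr (symplecticGroup_toLinearMap₂'_one K ι)).toMonoidHom.comp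
    (transportSp (1 : Matrix ι ι K) (isUnit_det_one' K ι))

/-- its underlying automorphism is that of `transportSp 1`. [cite: Weil1964, n° 5, p. 150] -/
@[simp] theorem coe_transportSpPi (A : Matrix.symplecticGroup ι K) :
    ((transportSpPi K ι A : symplecticGroup (polar (dotProductBilin K K (m := ι)))) :
        ((ι → K) × (ι → K)) ≃ₗ[K] ((ι → K) × (ι → K))) =
      (transportSp (1 : Matrix ι ι K) (isUnit_det_one' K ι) A : symplecticGroup _) := rfl

/-- the standard transport is surjective. [cite: Weil1964, n° 5, p. 150] -/
theorem transportSpPi_surjective : Function.Surjective (transportSpPi K ι) := fun g => by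
  obtain ⟨A, hA⟩ := transportSp_surjective (1 : Matrix ι ι K) (isUnit_det_one' K ι)
    ((MulEquiv.subgroupCongr (symplecticGroup_toLinearMap₂'_one K ι)).symm g)
  refine ⟨A, ?_⟩
  rw [transportSpPi, MonoidHom.comp_apply, hA, MulEquiv.coe_toMonoidHom, MulEquiv.apply_symm_apply]

variable {K ι}

omit [DecidableEq ι] in
/-- the compatibility `⟨-x, -y⟩ = ⟨x, y⟩` of the Levi pair `(-1, -1)`. [cite: Weil1964, n° 6, p. 151] -/
theorem dotProductBilin_neg_neg (x y : ι → K) :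
    dotProductBilin K K (LinearEquiv.neg K x) (LinearEquiv.neg K y) = dotProductBilin K K (m := ι) x y := by
  simp only [LinearEquiv.neg_apply, dotProductBilin_apply_apply, neg_dotProduct, dotProduct_neg, neg_neg]

omit [DecidableEq ι] in
/-- the self-duality relation of the Weyl element `(x, y) ↦ (y, -x)` (as in `LocalPiSchwartzBruhatFourier`).
[cite: Weil1964, n° 6, p. 151] -/
theorem dotProductBilin_refl_neg' (x y : ι → K) :
    dotProductBilin K K (LinearEquiv.refl K (ι → K) y) (LinearEquiv.neg K x) = -dotProductBilin K K (m := ι) x y := by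
  simp only [LinearEquiv.refl_apply, LinearEquiv.neg_apply, dotProductBilin_apply_apply, dotProduct_neg,
    dotProduct_comm y x]

/-- the transported `J` is `m(-1, -1) · w` with `w : (x, y) ↦ (y, -x)` the Weyl element of
`LocalPiSchwartzBruhatFourier.piWeylElt`. [cite: Weil1964, n° 6, p. 151] -/
theorem transportSpPi_J :
    transportSpPi K ι (SymplecticGroup.symJ ι K) =
      leviSp (dotProductBilin K K (m := ι)) (LinearEquiv.neg K) (LinearEquiv.neg K) dotProductBilin_neg_neg *
        weylSp (dotProductBilin K K (m := ι)) (LinearEquiv.refl K (ι → K)) (LinearEquiv.neg K)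
          dotProductBilin_refl_neg' := by
  apply Subtype.ext
  rw [coe_transportSpPi, transportSp_J, Subgroup.coe_mul, coe_weylSp]
  apply LinearEquiv.ext
  intro v
  rw [LinearEquiv.mul_apply, coe_leviSp_apply, coe_weylSp, weylσ_apply, weylσ_apply, weylGamma_apply,
    gramEquiv_symm_apply, Matrix.one_mulVec, inv_one, Matrix.one_mulVec]
  simp only [LinearEquiv.neg_apply, LinearEquiv.refl_apply, neg_neg]

/-- the transported Levi element is weil-1's `m(a, a⁻ᵀ)` for `⟨·, ·⟩`. [cite: Weil1964, n° 6, p. 151] -/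
theorem transportSpPi_levi (a : GL ι K) :
    ∃ had, transportSpPi K ι (levi a) =
      leviSp (dotProductBilin K K (m := ι)) (glEquiv a) (leviDual (1 : Matrix ι ι K) (isUnit_det_one' K ι) a) had := by
  have had := leviDual_compat (1 : Matrix ι ι K) (isUnit_det_one' K ι) a
  rw [toLinearMap₂'_one_eq_dotProductBilin] at had
  exact ⟨had, Subtype.ext (by rw [coe_transportSpPi, transportSp_levi]; rfl)⟩

variable [Invertible (2 : K)]

/-- the transported opposite unipotent is weil-1's `n(c)` for `⟨·, ·⟩`. [cite: Weil1964, n° 6, p. 151] -/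
theorem transportSpPi_low (c : Matrix ι ι K) (hc : c.IsSymm) :
    ∃ hb, transportSpPi K ι (low c hc) = unipotentSp (dotProductBilin K K (m := ι)) (lowLin (1 : Matrix ι ι K) c) hb := by
  have hb := lowLin_symm (1 : Matrix ι ι K) (isUnit_det_one' K ι) c hc
  rw [toLinearMap₂'_one_eq_dotProductBilin] at hb
  exact ⟨hb, Subtype.ext (by rw [coe_transportSpPi, transportSp_low]; rfl)⟩

/-- **generation of `Sp(K^ι ⊕ K^ι)` for a local ring `K` (e.g. a field)**: a subgroup of
`symplecticGroup (polar dotProductBilin)` containing every Levi element `m(a, d)`, every unipotent `n(b)` (`b`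
symmetric) and the Weyl element `(x, y) ↦ (y, -x)` is everything ("`Sp(W)` est engendré par `P(X)` et … `τ`";
Mathlib's big-cell lemma via `SymplecticSiegelGeneration`, transported by §1).
[cite: MoeglinVignerasWaldspurger1987, Chap. 2 II.5–II.6] -/
theorem symplecticGroup_pi_eq_top_of_mem [IsLocalRing K]
    {L : Subgroup (symplecticGroup (polar (dotProductBilin K K (m := ι))))}
    (hm : ∀ (a : (ι → K) ≃ₗ[K] (ι → K)) (d : (ι → K) ≃ₗ[K] (ι → K)) (had), leviSp (dotProductBilin K K) a d had ∈ L)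
    (hn : ∀ (b : (ι → K) →ₗ[K] (ι → K)) (hb), unipotentSp (dotProductBilin K K) b hb ∈ L)
    (hw : weylSp (dotProductBilin K K (m := ι)) (LinearEquiv.refl K (ι → K)) (LinearEquiv.neg K)
      dotProductBilin_refl_neg' ∈ L) :
    L = ⊤ := by
  have hc : L.comap (transportSpPi K ι) = ⊤ := by
    refine eq_top_of_generators_mem' (fun a => ?_) (fun c hc => ?_) ?_
    · obtain ⟨had, h⟩ := transportSpPi_levi a
      rw [Subgroup.mem_comap, h]
      exact hm _ _ had
    · obtain ⟨hb, h⟩ := transportSpPi_low c hc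
      rw [Subgroup.mem_comap, h]
      exact hn _ hb
    · rw [Subgroup.mem_comap, transportSpPi_J]
      exact L.mul_mem (hm _ _ _) hw
  rw [eq_top_iff]
  rintro g -
  obtain ⟨A, rfl⟩ := transportSpPi_surjective K ι g
  have hA : A ∈ L.comap (transportSpPi K ι) := by rw [hc]; exact Subgroup.mem_top A
  exact hA

end Standard

/-! ## §3 Existence of implementers on `𝒮(F^ι)` and the central extension -/

section Local

variable {F : Type*} [Field F] [ValuativeRel F] [TopologicalSpace F] [IsNonarchimedeanLocalField F]
  {ι : Type*} [Fintype ι] [DecidableEq ι] [Invertible (2 : F)]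
  (ψ : AddChar F Circle) (hl : IsLocallyConstant (⇑ψ : F → Circle))
  (hb : ∀ y : ι → F, Continuous fun u : ι → F => dotProductBilin F F u y)

variable {R : Type*} [CommRing R] {V : Type*} [AddCommGroup V] [Module R V] {B : V →ₗ[R] V →ₗ[R] R}
  {k : Type*} [CommRing k] {S : Type*} [AddCommGroup S] [Module k S] in
/-- `g` is implemented iff `g` is in the range of `p : S̃p_ψ(W) → Sp(W)`. [cite: MoeglinVignerasWaldspurger1987, Chap. 2 II.1 (B)] -/
theorem mem_range_proj_iff [Invertible (2 : R)] (ρ : Representation k (Heisenberg B) S) (g : symplecticGroup B) :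
    g ∈ (MpPsi.proj ρ).range ↔ ∃ M : S ≃ₗ[k] S, Implements ρ (ofSymplectic B g) M := by
  constructor
  · rintro ⟨x, hx⟩
    refine ⟨(x : symplecticGroup B × (S ≃ₗ[k] S)).2, ?_⟩
    have := x.2
    rw [mem_MpPsi] at this
    rw [MpPsi.proj_apply] at hx
    rwa [hx] at this
  · rintro ⟨M, hM⟩
    exact ⟨⟨(g, M), hM⟩, rfl⟩

omit [DecidableEq ι] in
/-- `x ↦ ⟨x, b x⟩` is continuous on `F^ι`. [folklore] -/
private theorem continuous_dotProductBilin_self (b : (ι → F) →ₗ[F] (ι → F)) :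
    Continuous fun x : ι → F => ⅟(2 : F) * dotProductBilin F F x (b x) := by
  have hbc : Continuous b := b.continuous_on_pi
  refine continuous_const.mul ?_
  simp only [dotProductBilin_apply_apply, dotProduct]
  exact continuous_finsetSum _ fun i _ => (continuous_apply i).mul ((continuous_apply i).comp hbc)

variable {ψ}

/-- **(A) in rank `n`: every `g ∈ Sp(F^ι ⊕ F^ι)` is implemented on the smooth Schrödinger model `𝒮(F^ι)`**, for
`ψ` continuous non-trivial and `2` invertible — Levi and unipotent operators (`SchrodingerSymplecticGenerators`),
the Fourier automorphism of `𝒮(F^ι)` for the Weyl element (`LocalPiSchwartzBruhatFourier`, any Haar measure), and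
generation (§2). [cite: MoeglinVignerasWaldspurger1987, Chap. 2 II.1 (A), II.6] -/
theorem existsImplementer_schrodingerSB_pi (hψ : ψ.IsContinuousNontrivial) :
    ExistsImplementer (schrodingerSB (dotProductBilin F F (m := ι)) ψ hl hb) := by
  set ρ := schrodingerSB (dotProductBilin F F (m := ι)) ψ hl hb with hρ
  -- the subgroup of implemented elements is everything
  have htop : (MpPsi.proj ρ).range = ⊤ := by
    refine symplecticGroup_pi_eq_top_of_mem (fun a d had => ?_) (fun b hb' => ?_) ?_
    · rw [mem_range_proj_iff]
      exact ⟨_, levi_mem_MpPsi (dotProductBilin F F) ψ hl hb a d had a.toLinearMap.continuous_on_pi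
        a.symm.toLinearMap.continuous_on_pi⟩
    · rw [mem_range_proj_iff]
      exact ⟨_, unipotent_mem_MpPsi (dotProductBilin F F) ψ hl hb b hb' (continuous_dotProductBilin_self b)⟩
    · rw [mem_range_proj_iff]
      -- a Haar measure on `F^ι` and the conductor of `ψ`
      letI : MeasurableSpace (ι → F) := borel (ι → F)
      haveI : BorelSpace (ι → F) := ⟨rfl⟩
      obtain ⟨m, hm⟩ := hψ.exists_hasConductorExp
      refine ⟨piFourierEquivSB (Measure.addHaar) hψ hm, ?_⟩
      rw [ofSymplectic_weylSp]
      exact piWeylPair_mem_mpPairs (Measure.addHaar) hψ hm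
  intro g
  rw [← mem_range_proj_iff, htop]
  exact Subgroup.mem_top g

/-- **(B) in rank `n`, hypothesis-free, KERNEL**: for every continuous non-trivial `ψ` of a non-archimedean local
field `F` with `2` invertible and every finite `ι`, `1 → ℂˣ → S̃p_ψ(F^ι ⊕ F^ι) → Sp(F^ι ⊕ F^ι) → 1`
(`MpPsi.ofScalar`, `MpPsi.proj` of the smooth Schrödinger model on `𝒮(F^ι)`) is a central extension with
`ker p = im i`. [cite: MoeglinVignerasWaldspurger1987, Chap. 2 II.1 (B)] -/
theorem isCentralExt_schrodingerSB_pi (hψ : ψ.IsContinuousNontrivial) :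
    Literature.RepresentationTheory.MoeglinVignerasWaldspurger1987.IsCentralExt
      (MpPsi.ofScalar (schrodingerSB (dotProductBilin F F (m := ι)) ψ hl hb))
      (MpPsi.proj (schrodingerSB (dotProductBilin F F (m := ι)) ψ hl hb)) :=
  isCentralExt_MpPsi _ (existsImplementer_schrodingerSB_pi hl hb hψ)
    (implementerUniqueUpToScalar_schrodingerSB_pi hl hb hψ)

/-- the same for the canonical proofs of local constancy / continuity (the form in which
`LocalPiSchwartzBruhatFourier.piWeylPair_mem_mpPairs` names the model). [cite: MoeglinVignerasWaldspurger1987, Chap. 2 II.1 (B)] -/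
theorem isCentralExt_schrodingerSB_pi' (hψ : ψ.IsContinuousNontrivial) :
    Literature.RepresentationTheory.MoeglinVignerasWaldspurger1987.IsCentralExt
      (MpPsi.ofScalar (schrodingerSB (dotProductBilin F F (m := ι)) ψ (isLocallyConstant_of_isContinuousNontrivial hψ)
        continuous_dotProductBilin_left))
      (MpPsi.proj (schrodingerSB (dotProductBilin F F (m := ι)) ψ (isLocallyConstant_of_isContinuousNontrivial hψ)
        continuous_dotProductBilin_left)) :=
  isCentralExt_schrodingerSB_pi _ _ hψ

end Local

end Literature.RepresentationTheory.HeisenbergGroup
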